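import Literature.MathematicalPhysics.QuantumManyBody.JelliumBoxHamiltonian
import Mathlib.Analysis.SpecialFunctions.SmoothTransition
import HarnessLib

/-!
# The localization function `χ_t` of Lieb–Solovej (3.4)

Topic `Literature/MathematicalPhysics/QuantumManyBody` (the charged Bose gas, `JelliumBoseGas.foldyLaw`).
[LiebSolovej2001, §3 (3.4)]: the sliding/kinetic localization uses `χ = χ_t ∈ C_c^∞`,
`0 ≤ χ_t ≤ 1`, supported in the unit cube and equal to `1` on the concentric cube of side
`1 - O(t)`, so that `∫χ_t² → 1` as `t → 0` (this is what makes `γ = (∫χ²)⁻¹ → 1` in §9). This file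
constructs such a family on the open unit box `Λ₁ = (0,1)³` of the tree from Mathlib's
`Real.smoothTransition`, and proves the properties required by the reduction
`chargedGroundStateEnergy_toReal_ge_boxes` / `lowerBoundOne_of_boxBound` (with `M = 1`):

* `JelliumBoseGas.plateau t` — a smooth one-dimensional plateau, `0` off `(t, 1-t)`, `1` on
  `[2t, 1-2t]`;
* `JelliumBoseGas.locFun t x = ∏ₖ plateau t (xₖ)` — `χ_t`;
* smoothness, `0 ≤ χ_t ≤ 1`, `χ_t = 0` off `box 1`, compact support, and
  `(1 - 4t)³ ≤ ∫χ_t²` (`integral_locFun_sq_ge`), hence `∫χ_t² ≠ 0` for `0 < t < 1/4`;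
* `JelliumBoseGas.locFun_admissible` — the conjunction used by `lowerBoundOne_of_boxBound`.

## References

* [LiebSolovej2001] E. H. Lieb, J. P. Solovej, Commun. Math. Phys. 217 (2001) 127–163, §3 (3.4)
  (arXiv:cond-mat/0007425, p. 7).
-/

noncomputable section

open MeasureTheory Set Filter Real
open scoped ENNReal NNReal Topology ContDiff

namespace Literature.MathematicalPhysics.QuantumManyBody.JelliumBoseGas

open BoseGas

/-! ### The one-dimensional plateau -/

/-- A smooth plateau: `σ((x-t)/t)·σ((1-t-x)/t)` with Mathlib's smooth transition `σ`
(`σ = 0` on `(-∞,0]`, `σ = 1` on `[1,∞)`). [cite: LiebSolovej2001, §3 (3.4)] -/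
def plateau (t x : ℝ) : ℝ :=
  Real.smoothTransition ((x - t) / t) * Real.smoothTransition ((1 - t - x) / t)

/-- `0 ≤ plateau`. [folklore] -/
theorem plateau_nonneg (t x : ℝ) : 0 ≤ plateau t x :=
  mul_nonneg (Real.smoothTransition.nonneg _) (Real.smoothTransition.nonneg _)

/-- `plateau ≤ 1`. [folklore] -/
theorem plateau_le_one (t x : ℝ) : plateau t x ≤ 1 :=
  mul_le_one₀ (Real.smoothTransition.le_one _) (Real.smoothTransition.nonneg _)
    (Real.smoothTransition.le_one _)

/-- The plateau vanishes for `x ≤ t` (`t > 0`). [folklore] -/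
theorem plateau_eq_zero_of_le {t x : ℝ} (ht : 0 < t) (hx : x ≤ t) : plateau t x = 0 := by
  unfold plateau
  rw [Real.smoothTransition.zero_of_nonpos (div_nonpos_of_nonpos_of_nonneg (by linarith) ht.le),
    zero_mul]

/-- The plateau vanishes for `1 - t ≤ x` (`t > 0`). [folklore] -/
theorem plateau_eq_zero_of_ge {t x : ℝ} (ht : 0 < t) (hx : 1 - t ≤ x) : plateau t x = 0 := by
  unfold plateau
  rw [Real.smoothTransition.zero_of_nonpos (x := (1 - t - x) / t)
    (div_nonpos_of_nonpos_of_nonneg (by linarith) ht.le), mul_zero]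

/-- The plateau equals `1` on `[2t, 1-2t]` (`t > 0`). [folklore] -/
theorem plateau_eq_one {t x : ℝ} (ht : 0 < t) (h1 : 2 * t ≤ x) (h2 : x ≤ 1 - 2 * t) :
    plateau t x = 1 := by
  unfold plateau
  rw [Real.smoothTransition.one_of_one_le ((one_le_div ht).2 (by linarith)),
    Real.smoothTransition.one_of_one_le ((one_le_div ht).2 (by linarith)), one_mul]

/-- The plateau is smooth. [folklore] -/
theorem contDiff_plateau (t : ℝ) : ContDiff ℝ ∞ (plateau t) := by
  unfold plateau
  exact (Real.smoothTransition.contDiff.comp ((contDiff_id.sub contDiff_const).div_const t)).mul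
    (Real.smoothTransition.contDiff.comp ((contDiff_const.sub contDiff_id).div_const t))

/-! ### The localization function on `ℝ³` -/

/-- **The localization function** `χ_t(x) = ∏ₖ plateau t (xₖ)` on `Space = ℝ³`: smooth,
`0 ≤ χ_t ≤ 1`, `χ_t = 0` off the open unit box, `χ_t = 1` on `[2t, 1-2t]³`.
[cite: LiebSolovej2001, §3 (3.4)] -/
def locFun (t : ℝ) (x : Space) : ℝ := plateau t (x 0) * plateau t (x 1) * plateau t (x 2)

/-- `0 ≤ χ_t`. [cite: LiebSolovej2001, §3 (3.4)] -/
theorem locFun_nonneg (t : ℝ) (x : Space) : 0 ≤ locFun t x :=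
  mul_nonneg (mul_nonneg (plateau_nonneg _ _) (plateau_nonneg _ _)) (plateau_nonneg _ _)

/-- `χ_t ≤ 1`. [cite: LiebSolovej2001, §3 (3.4)] -/
theorem locFun_le_one (t : ℝ) (x : Space) : locFun t x ≤ 1 :=
  mul_le_one₀ (mul_le_one₀ (plateau_le_one _ _) (plateau_nonneg _ _) (plateau_le_one _ _))
    (plateau_nonneg _ _) (plateau_le_one _ _)

/-- `χ_t` vanishes as soon as one coordinate is `≤ t` or `≥ 1 - t`. [folklore] -/
theorem locFun_eq_zero_of_coord {t : ℝ} (ht : 0 < t) {x : Space} {k : Fin 3}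
    (hk : x k ≤ t ∨ 1 - t ≤ x k) : locFun t x = 0 := by
  have h0 : plateau t (x k) = 0 := by
    rcases hk with h | h
    · exact plateau_eq_zero_of_le ht h
    · exact plateau_eq_zero_of_ge ht h
  unfold locFun
  fin_cases k
  · simp only [Fin.zero_eta] at h0; rw [h0]; ring
  · simp only [Fin.mk_one] at h0; rw [h0]; ring
  · have e : x ⟨2, by norm_num⟩ = x 2 := rfl
    rw [e] at h0; rw [h0]; ring

/-- `χ_t = 0` off the open unit box `Λ₁ = (0,1)³` (`0 < t`). [cite: LiebSolovej2001, §3 (3.4)] -/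
theorem locFun_eq_zero_of_not_mem_box {t : ℝ} (ht : 0 < t) (x : Space)
    (hx : x ∉ box 1) : locFun t x = 0 := by
  simp only [box, Set.mem_setOf_eq, not_forall, Set.mem_Ioo, not_and_or, not_lt] at hx
  obtain ⟨k, hk⟩ := hx
  refine locFun_eq_zero_of_coord ht (k := k) ?_
  rcases hk with h | h
  · exact Or.inl (h.trans ht.le)
  · exact Or.inr (by linarith)

/-- `χ_t = 1` on the cube `[2t, 1-2t]³`. [cite: LiebSolovej2001, §3 (3.4)] -/
theorem locFun_eq_one {t : ℝ} (ht : 0 < t) {x : Space}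
    (hx : ∀ k, x k ∈ Set.Icc (2 * t) (1 - 2 * t)) : locFun t x = 1 := by
  unfold locFun
  rw [plateau_eq_one ht (hx 0).1 (hx 0).2, plateau_eq_one ht (hx 1).1 (hx 1).2,
    plateau_eq_one ht (hx 2).1 (hx 2).2]
  ring

/-- `χ_t` is smooth. [cite: LiebSolovej2001, §3 (3.4)] -/
theorem contDiff_locFun (t : ℝ) : ContDiff ℝ ∞ (locFun t) := by
  have hk : ∀ k : Fin 3, ContDiff ℝ ∞ fun x : Space => x k := fun k =>
    (EuclideanSpace.proj (𝕜 := ℝ) k).contDiff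
  unfold locFun
  exact (((contDiff_plateau t).comp (hk 0)).mul ((contDiff_plateau t).comp (hk 1))).mul
    ((contDiff_plateau t).comp (hk 2))

/-- `χ_t` is continuous. [folklore] -/
theorem continuous_locFun (t : ℝ) : Continuous (locFun t) := (contDiff_locFun t).continuous

/-- Points of the unit box have norm at most `2`. [folklore] -/
theorem norm_le_two_of_mem_box {x : Space} (hx : x ∈ box 1) : ‖x‖ ≤ 2 := by
  rw [EuclideanSpace.norm_eq]
  have h : ∑ k, ‖x k‖ ^ 2 ≤ 4 := by
    have hk : ∀ k, ‖x k‖ ^ 2 ≤ 1 := fun k => by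
      have h1 := (hx k).1
      have h2 := (hx k).2
      rw [Real.norm_eq_abs, abs_of_nonneg h1.le]
      nlinarith
    calc ∑ k, ‖x k‖ ^ 2 ≤ ∑ _k : Fin 3, (1 : ℝ) := Finset.sum_le_sum fun k _ => hk k
      _ = 3 := by simp
      _ ≤ 4 := by norm_num
  calc Real.sqrt (∑ k, ‖x k‖ ^ 2) ≤ Real.sqrt 4 := Real.sqrt_le_sqrt h
    _ = 2 := by rw [show (4 : ℝ) = 2 ^ 2 by norm_num, Real.sqrt_sq (by norm_num)]

/-- `χ_t` has compact support (`0 < t`). [cite: LiebSolovej2001, §3 (3.4)] -/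
theorem hasCompactSupport_locFun {t : ℝ} (ht : 0 < t) : HasCompactSupport (locFun t) := by
  refine HasCompactSupport.intro (isCompact_closedBall (0 : Space) 2) fun x hx => ?_
  refine locFun_eq_zero_of_not_mem_box ht x fun hb => hx ?_
  rw [Metric.mem_closedBall, dist_zero_right]
  exact norm_le_two_of_mem_box hb

/-- `χ_t²` is integrable. [folklore] -/
theorem integrable_locFun_sq {t : ℝ} (ht : 0 < t) :
    Integrable fun x : Space => locFun t x ^ 2 := by
  have h : HasCompactSupport ((fun y : ℝ => y ^ 2) ∘ locFun t) :=
    (hasCompactSupport_locFun ht).comp_left (by simp)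
  exact ((continuous_locFun t).pow 2).integrable_of_hasCompactSupport h

/-- The volume of the coordinate cube `[a, b]³ ⊂ ℝ³`. [folklore] -/
theorem volume_coordCube (a b : ℝ) :
    volume {x : Space | ∀ k, x k ∈ Set.Icc a b} = ENNReal.ofReal (b - a) ^ 3 := by
  have h : {x : Space | ∀ k, x k ∈ Set.Icc a b} =
      (@WithLp.ofLp 2 (Fin 3 → ℝ)) ⁻¹' (Set.univ.pi fun _ => Set.Icc a b) := by
    ext x; simp only [Set.mem_setOf_eq, Set.mem_preimage, Set.mem_univ_pi]
  rw [h, (PiLp.volume_preserving_ofLp (Fin 3)).measure_preimage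
    (MeasurableSet.univ_pi fun _ => measurableSet_Icc).nullMeasurableSet, volume_pi_pi]
  simp only [Real.volume_Icc, Finset.prod_const, Finset.card_univ, Fintype.card_fin]

/-- The coordinate cube is measurable. [folklore] -/
theorem measurableSet_coordCube (a b : ℝ) : MeasurableSet {x : Space | ∀ k, x k ∈ Set.Icc a b} := by
  have h : {x : Space | ∀ k, x k ∈ Set.Icc a b} = ⋂ k, (fun x : Space => x k) ⁻¹' Set.Icc a b := by
    ext x; simp
  rw [h]
  exact MeasurableSet.iInter fun k => measurableSet_Icc.preimage (by fun_prop)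

/-- **`∫χ_t² ≥ (1 - 4t)³`** (`0 < t ≤ 1/4`): `χ_t = 1` on `[2t,1-2t]³`. Hence `γ_t = (∫χ_t²)⁻¹ → 1`
as `t → 0`. [cite: LiebSolovej2001, §3 (3.4) and §9] -/
theorem integral_locFun_sq_ge {t : ℝ} (ht : 0 < t) (ht4 : t ≤ 1 / 4) :
    (1 - 4 * t) ^ 3 ≤ ∫ x, locFun t x ^ 2 := by
  set S : Set Space := {x : Space | ∀ k, x k ∈ Set.Icc (2 * t) (1 - 2 * t)} with hS
  have hSm : MeasurableSet S := measurableSet_coordCube _ _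
  have hvol : (volume S).toReal = (1 - 4 * t) ^ 3 := by
    rw [hS, volume_coordCube, ENNReal.toReal_pow, ENNReal.toReal_ofReal (by linarith)]
    ring
  calc (1 - 4 * t) ^ 3 = ∫ x in S, (1 : ℝ) := by
        rw [setIntegral_const, smul_eq_mul, mul_one, measureReal_def, hvol]
    _ = ∫ x in S, locFun t x ^ 2 := by
        refine setIntegral_congr_fun hSm fun x hx => ?_
        rw [locFun_eq_one ht hx, one_pow]
    _ ≤ ∫ x, locFun t x ^ 2 :=
        setIntegral_le_integral (integrable_locFun_sq ht) (Eventually.of_forall fun x => sq_nonneg _)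

/-- `∫χ_t² ≠ 0` for `0 < t < 1/4`. [folklore] -/
theorem integral_locFun_sq_ne_zero {t : ℝ} (ht : 0 < t) (ht4 : t < 1 / 4) :
    (∫ x, locFun t x ^ 2) ≠ 0 := by
  have h := integral_locFun_sq_ge ht ht4.le
  have hpos : 0 < (1 - 4 * t) ^ 3 := pow_pos (by linarith) 3
  linarith

/-- **`χ_t` is an admissible localization function** for the reduction to small boxes
(`chargedGroundStateEnergy_toReal_ge_boxes`, `lowerBoundOne_of_boxBound` with `M = 1`), for
`0 < t < 1/4`. [cite: LiebSolovej2001, §3 (3.4)] -/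
theorem locFun_admissible {t : ℝ} (ht : 0 < t) (ht4 : t < 1 / 4) :
    ContDiff ℝ (⊤ : ℕ∞) (locFun t) ∧ HasCompactSupport (locFun t) ∧
      (∫ u, locFun t u ^ 2) ≠ 0 ∧ (∀ x, 0 ≤ locFun t x) ∧ (∀ x, locFun t x ≤ 1) ∧
      (∀ x, x ∉ box 1 → locFun t x = 0) :=
  ⟨contDiff_locFun t, hasCompactSupport_locFun ht, integral_locFun_sq_ne_zero ht ht4,
    locFun_nonneg t, locFun_le_one t, locFun_eq_zero_of_not_mem_box ht⟩

end Literature.MathematicalPhysics.QuantumManyBody.JelliumBoseGas
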